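import Summits.CriticalPhenomena.SAWScalingLimit.Theses.SAWLoopLift
import Literature.Probability.RandomPlanarGeometry.SLEExistenceNeEightHolds
import HarnessLib

/-!
# Route `SAWLoopLift`: the assembly item `Assembly` (stmt-CriticalPhenomena-4852)

The assembly frame of the route is

  `Assembly := ConformalRadiusLaw → GasRegularity → BoundaryMixing → GateFactorisation →
    AvoidanceToCurves → SAWScalingLimit`.

The route file already proves the deciding theorem
`closes : SLELawExists → ConformalRadiusLaw → GasRegularity → BoundaryMixing → GateFactorisation →
AvoidanceToCurves → SAWScalingLimit` (an `ε/3` argument), whose only extra hypothesis is the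
support item `SLELawExists` — existence of a chordal SLE(8/3) law in every Dobrushin domain.  That
support item is a theorem of the tree: Rohde–Schramm, Thm. 5.1 (the SLE_κ trace is a curve for
`κ ≠ 8`) and Thm. 7.1 (transience), assembled in
`Literature.Probability.RandomPlanarGeometry.exists_isSLELaw_of_ne_eight` (file
`SLEExistenceNeEightHolds.lean`, deliberately kept out of the route file's import cone).  Hence:

* `sawLoopLift_sleLawExists : SLELawExists` — the support item, discharged;
* `sawLoopLift_assembly_proof : Assembly` — the item, `closes` fed with `sawLoopLift_sleLawExists`.

No new definitions.

## References

* S. Rohde, O. Schramm, *Basic properties of SLE*, Ann. of Math. 161 (2005), Thm. 5.1, Thm. 7.1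
  [RohdeSchramm2005].
* W. Werner, *The conformally invariant measure on self-avoiding loops*, J. Amer. Math. Soc. 21
  (2008) [Werner2008SelfAvoidingLoops] (the route).
-/

noncomputable section

open scoped NNReal

namespace Summit.CriticalPhenomena.SAWScalingLimit.Theorems

open Summit.CriticalPhenomena.SAWScalingLimit.Theses.SAWLoopLift

/-- **The support item `SLELawExists` holds** (stmt-CriticalPhenomena-10341): in every Dobrushin
domain `(D; a, b)` some measure `μ` on `CurveClass ℂ` is the law of a chordal SLE_{8/3} random
curve (`IsSLELaw (8/3) D μ`).  Rohde–Schramm Thm. 5.1 + Thm. 7.1 at `κ = 8/3 ≠ 8`, via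
`Literature.Probability.RandomPlanarGeometry.exists_isSLELaw_of_ne_eight`.
[cite: RohdeSchramm2005, Thm 5.1 and Thm 7.1] -/
theorem sawLoopLift_sleLawExists :
    Summit.CriticalPhenomena.SAWScalingLimit.Theses.SAWLoopLift.SLELawExists := by
  unfold Summit.CriticalPhenomena.SAWScalingLimit.Theses.SAWLoopLift.SLELawExists
  intro D
  exact Literature.Probability.RandomPlanarGeometry.exists_isSLELaw_of_ne_eight
    (κ := (8 : ℝ≥0) / 3) (by positivity) (by norm_num) D

/-- **The assembly item of route `SAWLoopLift`** (stmt-CriticalPhenomena-4852):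
`ConformalRadiusLaw → GasRegularity → BoundaryMixing → GateFactorisation → AvoidanceToCurves →
SAWScalingLimit`.  Proof: the route's deciding theorem `closes` (the `ε/3` bookkeeping — `μ` a
chordal SLE_{8/3} law, `AvoidanceToCurves` reduces to avoidance probabilities of regular-closed
compacta, `ConformalRadiusLaw` gives `c`, `GasRegularity` the hyperspace measure `ν` and the two
`δ`-limits of the gate masses, `GateFactorisation` the `ε`-limit of their ratio, `BoundaryMixing`
the lattice comparison) applied to the discharged support item `sawLoopLift_sleLawExists`.
[cite: RohdeSchramm2005, Thm 5.1 and Thm 7.1] -/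
theorem sawLoopLift_assembly_proof :
    Summit.CriticalPhenomena.SAWScalingLimit.Theses.SAWLoopLift.Assembly := by
  unfold Summit.CriticalPhenomena.SAWScalingLimit.Theses.SAWLoopLift.Assembly
  intro h1 h2 h3 h4 h5
  exact closes sawLoopLift_sleLawExists h1 h2 h3 h4 h5

end Summit.CriticalPhenomena.SAWScalingLimit.Theorems

end
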